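import Summits.ResolutionOfSingularities.ResolutionOfSingularities.Theorems.HilbertSamuelEliminationSigmaMaxModificationsCorridor3WLadderGradeOneUnits
import Summits.ResolutionOfSingularities.ResolutionOfSingularities.Theorems.HilbertSamuelEliminationSigmaMaxModificationsCorridor3IsolatedCentre
import Literature.AlgebraicGeometry.Resolution.GenericPointsOfClosure
import HarnessLib

/-!
# [OURS · L1 W4.2] THE STAGE TOWER of an eventually-isolated moving chain: iterated blow-ups of the marked closed points over
# a REACHED STAGE realising the local rings of the marked points, and the de-localisation of isolation in the Hilbert–Samuel
# locus — bricks for `IsoTailTowerExtractionM` (W4.2 DEAL D7 «ISO-TAIL EXTRACTION»; crux `SigmaMaxModifications`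
# stmt-ResolutionOfSingularities-18506, conjunct `SigmaMaxModificationsCorridor3` stmt-…-19249; line `w_ladder` v6, the
# eventually-isolated half `WtopEvIsoM` of the W-top CORE; `--supports stmt-ResolutionOfSingularities-19249`, helper)

OURS (cell res-hironaka, slot W4.2, seat res-D-pv-042 AS W4.2 DEAL hand D7); NOT statements of H. Hironaka's manuscript
[Hironaka2017] nor of [CossartJannsenSaito2020]. AI-drafted, weaker than expert review. Sorry-free PROOF file (no new
definition), fact-free (no named fact is consumed).

* `Moving.exists_stageTower` — res-L1-w42-stub-2's local-tower recursion `Moving.exists_localTower`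
  (`…Corridor3WLadderLocalTower`) RE-BASED AT THE STAGE ITSELF: from a sequence of genuine steps — blow-ups `π_j : X'_j → X_j` in
  centres `C_j = 𝓘(V(C_j))` with `(C_j)_{x_j} = 𝔪_{x_j}`, closed points `x'_j` over `x_j`, links `𝒪_{X'_j,x'_j} ≅ 𝒪_{X_{j+1},x_{j+1}}` —
  a tower `T` with `T.X 0 = X_0`, `y_0 = x_0`, `T.X (j+1) = Bℓ_{y_j}(T.X j)`, closed marked points `y_{j+1} ↦ y_j` and
  `𝒪_{T.X j,y_j} ≅ 𝒪_{X_j,x_j}`. The base is a scheme of finite type over the field (a maximal origin), which the `Spec 𝒪`-base of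
  the local tower cannot be; the recursion step is stub-2's `exists_localStep_isClosed` verbatim.
* `isIsolatedInHSMaxLocus_of_spec` — DE-LOCALISATION: for a closed point `y` of the Hilbert–Samuel locus `Y_max` of a noetherian
  scheme with `Y_max` closed, isolation of the closed point of `Spec 𝒪_{Y,y}` in its Hilbert–Samuel locus gives isolation of `y`
  in `Y_max` (no proper generisation of `y` lies in `Y_max`; the irreducible pieces of `cl(Y_max ∖ {y})` through `y` would have
  their generic points there). Converse companion of res-type-053's `BlowupTower.isIsolatedInHSMaxLocus_localize`.
* `BlowupTower.exists_structure_of_isMaximalOrigin`, `BlowupTower.supMax_of_isMaximalOrigin` — along a tower of blow-ups of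
  closed marked points over a maximal origin `(T.X 0, y_0)` whose centres are permissible: every stage is of finite type over the
  field with `dim ≤ N`, and `ν` is never exceeded (`IsBlowup.hsFun_le_of_isPermissible`, CJS Thm. 3.10 (1) as proved in the tree).
* `Moving.exists_genuineStep_of_iso`, `Moving.exists_isoStageTower_of_movingChain` — the genuine steps of a moving chain at
  ISOLATED marked points (stub-1's characteristic-free kernel `IsMaximalOrigin.stalkIdeal_centre_eq_maximalIdeal_of_iso`: the
  canonical centre is `𝔪` at an isolated marked point) and the stage tower of such a chain from its first genuine stage.

## References

* V. Cossart, U. Jannsen, S. Saito, LNM 2270 (2020): p. 107, Thm. 3.10 (1), Def. 6.34, Def. 6.38, Def. 13.3, Rem. 6.29 (1). [CossartJannsenSaito2020]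
* U. Görtz, T. Wedhorn, *Algebraic Geometry I* (2nd ed. 2020), Def. 13.90, Prop. 13.91. [GortzWedhorn2020]
* The Stacks Project, Tags 01J7, 02NS, 07QW. [StacksProject]
-/

noncomputable section

-- namespace `…Corridor3.Moving` re-enters `…Corridor3` (module convention of the Moving files)
set_option linter.dupNamespace false

open CategoryTheory CategoryTheory.Limits AlgebraicGeometry TopologicalSpace IsLocalRing
open Literature.AlgebraicGeometry.Resolution Literature.RingTheory.HilbertSamuel
open Scheme.IdealSheafData

universe u

open Literature.AlgebraicGeometry.CossartJannsenSaito2020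
open Summit.ResolutionOfSingularities.ResolutionOfSingularities.Theorems.CampaignW42

namespace Summit.ResolutionOfSingularities.ResolutionOfSingularities.Theorems.SigmaMaxModificationsCorridor3.Moving

/-! ## §1. The stage tower: stub-2's recursion re-based at the stage -/

/-- **THE STAGE TOWER**: from a sequence of genuine steps — blow-ups `π_j : X'_j → X_j` in centres `C_j = 𝓘(V(C_j))` with
`(C_j)_{x_j} = 𝔪_{x_j}`, closed points `x'_j` over `x_j`, links `𝒪_{X'_j,x'_j} ≅ 𝒪_{X_{j+1},x_{j+1}}`, and a CLOSED `x_0` — a tower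
of blow-ups of closed points whose stage `0` IS `X_0` with marked point `x_0` (every property of `(X_0, x_0)` transfers), whose
marked closed points `y_j` have the local rings `𝒪_{X_j,x_j}`. [cite: CossartJannsenSaito2020, p. 107, Def. 6.34, Def. 6.38] -/
theorem exists_stageTower {W W' : ℕ → Scheme.{u}} [hW : ∀ j, IsLocallyNoetherian (W j)]
    (π : ∀ j, W' j ⟶ W j) (C : ∀ j, (W j).IdealSheafData) (hπ : ∀ j, IsBlowup (π j) (C j))
    (hC : ∀ j, C j = vanishingIdeal (C j).support) (x : ∀ j, W j)
    (hx : ∀ j, stalkIdeal (C j) (x j) = maximalIdeal ((W j).presheaf.stalk (x j))) (x' : ∀ j, W' j)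
    (hx' : ∀ j, (π j).base (x' j) = x j) (hcl : ∀ j, IsClosed ({x' j} : Set (W' j)))
    (link : ∀ j, Nonempty ((W' j).presheaf.stalk (x' j) ≅ (W (j + 1)).presheaf.stalk (x (j + 1))))
    (hx0 : IsClosed ({x 0} : Set (W 0))) :
    ∃ (T : BlowupTower.{u}) (y : ∀ j, T.X j),
      (∀ j, T.C j = {y j}) ∧ (∀ j, IsClosed ({y j} : Set (T.X j))) ∧ (∀ j, (T.π j).base (y (j + 1)) = y j) ∧
      (∀ j, Nonempty ((T.X j).presheaf.stalk (y j) ≅ (W j).presheaf.stalk (x j))) ∧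
      (∀ P : ∀ Y : Scheme.{u}, Y → Prop, P (W 0) (x 0) → P (T.X 0) (y 0)) := by
  classical
  -- the state reached after `j` blow-ups: a stage, its marked closed point, and the identification of local rings
  let St : ℕ → Type (u + 1) := fun j =>
    Σ' (Y : Scheme.{u}) (_ : IsLocallyNoetherian Y) (y : Y) (_ : IsClosed ({y} : Set Y)),
      Y.presheaf.stalk y ≅ (W j).presheaf.stalk (x j)
  -- stage 0: the stage `X_0` itself at `x_0`
  let st0 : St 0 := ⟨W 0, hW 0, x 0, hx0, Iso.refl _⟩
  -- the step: blow up the marked point and transport along the genuine step `j`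
  let stepFn : ∀ j, St j → St (j + 1) := fun j s =>
    haveI : IsLocallyNoetherian s.1 := s.2.1
    haveI : IsLocallyNoetherian (blowup (vanishingIdeal (⟨{s.2.2.1}, s.2.2.2.1⟩ : Closeds s.1))) :=
      CentreSeq.isLocallyNoetherian_blowup _
    let h := exists_localStep_isClosed s.2.2.2.1 (blowup.isBlowup _) (hπ j) (hC j) (hx j) s.2.2.2.2 (hx' j) (hcl j)
    ⟨blowup (vanishingIdeal (⟨{s.2.2.1}, s.2.2.2.1⟩ : Closeds s.1)), inferInstance, h.choose, h.choose_spec.2.1,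
      Classical.choice h.choose_spec.2.2 ≪≫ Classical.choice (link j)⟩
  let st : ∀ j, St j := fun j => Nat.rec (motive := St) st0 (fun j s => stepFn j s) j
  -- the tower
  let T : BlowupTower.{u} :=
    { X := fun j => (st j).1
      ln := fun j => (st j).2.1
      C := fun j => {(st j).2.2.1}
      isClosed_C := fun j => (st j).2.2.2.1
      π := fun j => blowup.π (vanishingIdeal (⟨{(st j).2.2.1}, (st j).2.2.2.1⟩ : Closeds (st j).1))
      isBlowup := fun j => blowup.isBlowup _ }
  refine ⟨T, fun j => (st j).2.2.1, fun j => rfl, fun j => (st j).2.2.2.1, fun j => ?_, fun j => ⟨(st j).2.2.2.2⟩,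
    fun P hP => hP⟩
  -- `y_{j+1}` lies over `y_j`: the choice in `stepFn`
  haveI : IsLocallyNoetherian (st j).1 := (st j).2.1
  haveI : IsLocallyNoetherian (blowup (vanishingIdeal (⟨{(st j).2.2.1}, (st j).2.2.2.1⟩ : Closeds (st j).1))) :=
    CentreSeq.isLocallyNoetherian_blowup _
  exact (exists_localStep_isClosed (st j).2.2.2.1 (blowup.isBlowup _) (hπ j) (hC j) (hx j) (st j).2.2.2.2
    (hx' j) (hcl j)).choose_spec.1


/-! ## §2. De-localisation of isolation in the Hilbert–Samuel locus -/

/-- **Isolation in the Hilbert–Samuel locus DE-LOCALISES.** Let `Y` be a noetherian scheme whose Hilbert–Samuel locus `Y_max` is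
closed, `y ∈ Y_max` a closed point. If the closed point of `Spec 𝒪_{Y,y}` is isolated in the Hilbert–Samuel locus of the local
scheme, then `y` is isolated in `Y_max`: a generisation `z ⤳ y` in `Y_max` is a point of `Spec 𝒪_{Y,y}` with the same `H^N`
(`Scheme.hsFun_fromSpecStalk`), maximal there as well, hence the closed point; and a point of the closure of `Y_max ∖ {y}`
is a specialisation of a point of `Y_max ∖ {y}` (`exists_mem_inter_specializes_of_mem_closure`), so `y` is not in that closure.
Converse companion of `BlowupTower.isIsolatedInHSMaxLocus_localize`. [cite: CossartJannsenSaito2020, Def. 13.3, Lemma 2.36] -/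
theorem isIsolatedInHSMaxLocus_of_spec {Y : Scheme.{u}} [IsNoetherian Y] (N : ℕ) {y : Y}
    (hy : IsClosed ({y} : Set Y)) (hmax : y ∈ Scheme.hsMaxLocus Y N) (hcl : IsClosed (Scheme.hsMaxLocus Y N))
    (h : IsIsolatedInHSMaxLocus (Spec ((Y.presheaf).stalk y)) N (closedPoint (Y.presheaf.stalk y))) :
    IsIsolatedInHSMaxLocus Y N y := by
  -- (A) no proper generisation of `y` lies in `Y_max`
  have hA : ∀ z ∈ Scheme.hsMaxLocus Y N, z ⤳ y → z = y := by
    intro z hz hzy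
    have hzr : z ∈ Set.range (Y.fromSpecStalk y).base := by
      rw [Scheme.range_fromSpecStalk]; exact hzy
    obtain ⟨s, hs⟩ := hzr
    obtain ⟨U, hU, hUmax⟩ := h
    have hcU : closedPoint (Y.presheaf.stalk y) ∈ U := by
      have : closedPoint (Y.presheaf.stalk y) ∈ U ∩ Scheme.hsMaxLocus (Spec (Y.presheaf.stalk y)) N := by
        rw [hUmax]; exact Set.mem_singleton _
      exact this.1
    have hsU : s ∈ U := (IsLocalRing.specializes_closedPoint s).mem_open hU hcU
    have hsmax : s ∈ Scheme.hsMaxLocus (Spec (Y.presheaf.stalk y)) N := by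
      rw [Scheme.mem_hsMaxLocus_iff]
      refine ⟨⟨s, rfl⟩, ?_⟩
      rintro μ ⟨s', rfl⟩ hle
      rw [Scheme.hsFun_fromSpecStalk, Scheme.hsFun_fromSpecStalk, hs] at hle ⊢
      exact (Scheme.mem_hsMaxLocus_iff.mp hz).2 ⟨_, rfl⟩ hle
    have hs' : s ∈ U ∩ Scheme.hsMaxLocus (Spec (Y.presheaf.stalk y)) N := ⟨hsU, hsmax⟩
    rw [hUmax, Set.mem_singleton_iff] at hs'
    rw [← hs, hs', Scheme.fromSpecStalk_closedPoint]
  -- (B) `y` is not in the closure of `Y_max ∖ {y}`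
  have hncl : y ∉ closure (Scheme.hsMaxLocus Y N ∩ {y}ᶜ) := by
    intro hmem
    obtain ⟨ξ, ⟨hξmax, hξne⟩, hξy⟩ := exists_mem_inter_specializes_of_mem_closure hcl hy.isOpen_compl hmem
    exact hξne (hA ξ hξmax hξy)
  refine ⟨(closure (Scheme.hsMaxLocus Y N ∩ {y}ᶜ))ᶜ, isClosed_closure.isOpen_compl, ?_⟩
  ext w
  simp only [Set.mem_inter_iff, Set.mem_compl_iff, Set.mem_singleton_iff]
  constructor
  · rintro ⟨hw, hwmax⟩
    by_contra hne
    exact hw (subset_closure ⟨hwmax, hne⟩)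
  · rintro rfl
    exact ⟨hncl, hmax⟩

/-! ## §3. Bookkeeping along a tower of point blow-ups over a maximal origin -/

/-- **Every stage of a tower of blow-ups over a scheme separated and of finite type over a field is again separated and of
finite type over that field** (blow-ups are proper: `IsBlowup.isProper`, Stacks 02NS). [cite: StacksProject, Tag 02NS] -/
theorem exists_towerStructure (T : BlowupTower.{u}) {k : Type u} [Field k] (f₀ : T.X 0 ⟶ Spec (.of k))
    [IsSeparated f₀] [LocallyOfFiniteType f₀] [QuasiCompact f₀] :
    ∃ f : ∀ j, T.X j ⟶ Spec (.of k),
      (∀ j, IsSeparated (f j)) ∧ (∀ j, LocallyOfFiniteType (f j)) ∧ (∀ j, QuasiCompact (f j)) := by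
  let f : ∀ j, T.X j ⟶ Spec (.of k) := fun j =>
    Nat.rec (motive := fun j => T.X j ⟶ Spec (.of k)) f₀ (fun j fj => T.π j ≫ fj) j
  have hf : ∀ j, f (j + 1) = T.π j ≫ f j := fun j => rfl
  have key : ∀ j, IsSeparated (f j) ∧ LocallyOfFiniteType (f j) ∧ QuasiCompact (f j) := by
    intro j
    induction j with
    | zero => exact ⟨‹_›, ‹_›, ‹_›⟩
    | succ j ih =>
      obtain ⟨h1, h2, h3⟩ := ih
      haveI : IsLocallyNoetherian (T.X j) := T.ln j
      haveI : IsProper (T.π j) := (T.isBlowup j).isProper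
      rw [hf]
      exact ⟨inferInstance, inferInstance, inferInstance⟩
  exact ⟨f, fun j => (key j).1, fun j => (key j).2.1, fun j => (key j).2.2⟩

/-- The level bounds the dimension of every stage of a tower of blow-ups (`IsBlowup.topologicalKrullDim_le_of_isLocallyNoetherian`).
[cite: GortzWedhorn2020, Prop. 13.91] -/
theorem tower_dim_le (T : BlowupTower.{u}) {N : ℕ} (h0 : topologicalKrullDim (T.X 0) ≤ (N : WithBot ℕ∞)) (j : ℕ) :
    topologicalKrullDim (T.X j) ≤ (N : WithBot ℕ∞) := by
  induction j with
  | zero => exact h0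
  | succ j ih =>
    haveI : IsLocallyNoetherian (T.X j) := T.ln j
    exact (T.isBlowup j).topologicalKrullDim_le_of_isLocallyNoetherian ih

/-- **`ν` is never exceeded along a tower of PERMISSIBLE blow-ups of excellent stages** if it is never exceeded at stage `0`
(`IsBlowup.hsFun_le_of_isPermissible`: `H^N` does not increase under a permissible blow-up, CJS Thm. 3.10 (1)).
[cite: CossartJannsenSaito2020, Thm. 3.10 (1)] -/
theorem tower_supMax (T : BlowupTower.{u}) {N : ℕ} {ν : ℕ → ℕ} (hexc : ∀ j, Scheme.IsExcellent (T.X j))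
    (hperm : ∀ j, IdealSheafData.IsPermissible (T.centreIdeal j))
    (h0 : ∀ w : T.X 0, ν ≤ Scheme.hsFun (T.X 0) N w → Scheme.hsFun (T.X 0) N w = ν) (j : ℕ) :
    ∀ w : T.X j, ν ≤ Scheme.hsFun (T.X j) N w → Scheme.hsFun (T.X j) N w = ν := by
  induction j with
  | zero => exact h0
  | succ j ih =>
    intro w hw
    haveI : IsLocallyNoetherian (T.X j) := T.ln j
    haveI : IsLocallyNoetherian (T.X (j + 1)) := T.ln (j + 1)
    have hle := (T.isBlowup j).hsFun_le_of_isPermissible (hexc j) (hperm j) N w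
    have heq := ih _ (hw.trans hle)
    exact le_antisymm (heq ▸ hle) hw

/-! ## §4. Genuine steps at isolated marked points and the stage tower of a moving chain -/

variable {R : ∀ S : Scheme.{u}, CentreSeq S → Prop} {N : ℕ} {ν : ℕ → ℕ}

/-- **THE GENUINE STEP at a blown-up ISOLATED marked point** (chain from a maximal origin, `ν ≠ Φ^{(N)}`; characteristic-free,
fact-free): THE canonical centre `C` is the reduced structure on its support, `C_{x_n} = 𝔪_{x_n}` (stub-1's
`IsMaximalOrigin.stalkIdeal_centre_eq_maximalIdeal_of_iso`), and the next marked point is a closed point `x'` of `Bℓ_C(X_n)`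
over `x_n` with `𝒪_{Bℓ_C(X_n),x'} = 𝒪_{X_{n+1},x_{n+1}}`. [cite: CossartJannsenSaito2020, Def. 13.3, Def. 6.34 (i), Rem. 6.29 (1)] -/
theorem exists_genuineStep_of_iso (hRf : OracleFunctional R) (hRa : OracleAdmissible R) {p : ℕ} {X : Scheme.{u}}
    [IsLocallyNoetherian X] {x : X} (hX : IsMaximalOrigin p N ν X x) (hν : ν ≠ iterPSum N Phi)
    {s s' : MarkedStage.{u}} (hreach : Reaches R N ν (MarkedStage.init X x) s) (hst : CanonicalNearStep R N ν s s')
    (hb : s.IsBlownUp R N ν) (hiso : Iso N s) :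
    ∃ (C : s.W.IdealSheafData) (x' : ↥(blowup C)),
      C = vanishingIdeal C.support ∧ stalkIdeal C s.pt = @maximalIdeal (s.W.presheaf.stalk s.pt) _ _ ∧
        (blowup.π C).base x' = s.pt ∧ IsClosed ({x'} : Set ↥(blowup C)) ∧
          Nonempty ((blowup C).presheaf.stalk x' ≅ s'.W.presheaf.stalk s'.pt) := by
  haveI : IsLocallyNoetherian s.W := s.ln
  obtain ⟨k, _, _, hg⟩ := hX.exists_stateGood_of_reaches hRa hν hreach
  obtain ⟨C, P', hcs, hmem⟩ := hb
  have hmax : stalkIdeal C s.pt = maximalIdeal (s.W.presheaf.stalk s.pt) :=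
    hX.stalkIdeal_centre_eq_maximalIdeal_of_iso hRa hν hreach hiso hcs hmem
  obtain ⟨C₂, P₂', hln, x', hcs₂, hπ, hcl, -, rfl⟩ := hst
  obtain rfl : C = C₂ := IsCanonicalStep.centre_unique hRf hcs hcs₂
  have hreg : Scheme.IsRegular C.subscheme := isRegular_subscheme_of_isPermissible (hg.isPermissible hcs)
  exact ⟨C, x', eq_vanishingIdeal_support_of_isRegular C hreg, hmax, hπ, hcl, ⟨Iso.refl _⟩⟩

/-- **FROM A MOVING CHAIN WITH ISOLATED BLOWN-UP POINTS TO ITS STAGE TOWER** (fact-free): let `c` be a chain of canonical near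
steps from a maximal origin `(X, x)` with `ν ≠ Φ^{(N)}`, blown up infinitely often, whose blown-up marked points are ISOLATED in
the Hilbert–Samuel locus. Then there are the GENUINE STAGES `n_0 < n_1 < ⋯` (all blown-up stages from `n_0` on) and a tower `T`
of blow-ups of closed points with `T.X 0 = X_{n_0}`, `y_0 = x_{n_0}` (every property of `(X_{n_0}, x_{n_0})` transfers), closed
marked points `y_{j+1} ↦ y_j`, `T.C j = {y_j}`, and `𝒪_{T.X j,y_j} ≅ 𝒪_{X_{n_j},x_{n_j}}`. [cite: CossartJannsenSaito2020, p. 107, Def. 6.34, Def. 6.38, Rem. 6.29 (1)] -/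
theorem exists_isoStageTower_of_movingChain (hRf : OracleFunctional R) (hRa : OracleAdmissible R) {p : ℕ}
    {X : Scheme.{u}} [IsLocallyNoetherian X] {x : X} (hX : IsMaximalOrigin p N ν X x) (hν : ν ≠ iterPSum N Phi)
    {c : ℕ → MarkedStage.{u}} (h0 : Reaches R N ν (MarkedStage.init X x) (c 0))
    (hstep : ∀ n, CanonicalNearStep R N ν (c n) (c (n + 1))) (hmov : ∀ n, ∃ m, n ≤ m ∧ (c m).IsBlownUp R N ν)
    (hI : ∀ n, (c n).IsBlownUp R N ν → Iso N (c n)) :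
    ∃ (g : ℕ → ℕ) (T : BlowupTower.{u}) (y : ∀ j, T.X j),
      StrictMono g ∧ (∀ j, (c (g j)).IsBlownUp R N ν) ∧ (∀ m, g 0 ≤ m → (c m).IsBlownUp R N ν → ∃ j, g j = m) ∧
      (∀ j, T.C j = {y j}) ∧ (∀ j, IsClosed ({y j} : Set (T.X j))) ∧ (∀ j, (T.π j).base (y (j + 1)) = y j) ∧
      (∀ j, Nonempty ((T.X j).presheaf.stalk (y j) ≅ (c (g j)).W.presheaf.stalk (c (g j)).pt)) ∧
      (∀ P : ∀ Y : Scheme.{u}, Y → Prop, P (c (g 0)).W (c (g 0)).pt → P (T.X 0) (y 0)) := by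
  classical
  -- the genuine stages: `next n` = the first blown-up stage `≥ n`
  let next : ℕ → ℕ := fun n => Nat.find (hmov n)
  have next_spec : ∀ n, n ≤ next n ∧ (c (next n)).IsBlownUp R N ν := fun n => Nat.find_spec (hmov n)
  have next_min : ∀ n m, n ≤ m → (c m).IsBlownUp R N ν → next n ≤ m :=
    fun n m hnm hb => Nat.find_min' (hmov n) ⟨hnm, hb⟩
  have next_wait : ∀ n m, n ≤ m → m < next n → ¬ (c m).IsBlownUp R N ν :=
    fun n m hnm hlt hb => absurd (next_min n m hnm hb) (not_le.mpr hlt)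
  let g : ℕ → ℕ := fun j => Nat.rec (next 0) (fun _ gj => next (gj + 1)) j
  have g_succ : ∀ j, g (j + 1) = next (g j + 1) := fun j => rfl
  have g_blown : ∀ j, (c (g j)).IsBlownUp R N ν := by
    intro j
    cases j with
    | zero => exact (next_spec 0).2
    | succ j => rw [g_succ]; exact (next_spec _).2
  have g_lt : ∀ j, g j < g (j + 1) := fun j => by
    rw [g_succ]; exact Nat.lt_of_lt_of_le (Nat.lt_succ_self _) (next_spec _).1
  have g_mono : StrictMono g := strictMono_nat_of_lt_succ g_lt
  have g_all : ∀ m, g 0 ≤ m → (c m).IsBlownUp R N ν → ∃ j, g j = m := by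
    intro m hm hb
    have hex : ∃ j, m < g (j + 1) := ⟨m, Nat.lt_of_lt_of_le (Nat.lt_succ_self m) (g_mono.id_le (m + 1))⟩
    obtain ⟨j₀, hj₀, hmin⟩ : ∃ j₀, m < g (j₀ + 1) ∧ ∀ k < j₀, ¬ m < g (k + 1) :=
      ⟨Nat.find hex, Nat.find_spec hex, fun k hk => Nat.find_min hex hk⟩
    have hle : g j₀ ≤ m := by
      cases j₀ with
      | zero => exact hm
      | succ k => exact not_lt.mp (hmin k (Nat.lt_succ_self k))
    refine ⟨j₀, le_antisymm hle (not_lt.mp fun hlt => ?_)⟩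
    have h1 : g (j₀ + 1) ≤ m := by rw [g_succ]; exact next_min _ m hlt hb
    exact absurd hj₀ (not_lt.mpr h1)
  -- the genuine step data at each `g j`
  have hreach : ∀ n, Reaches R N ν (MarkedStage.init X x) (c n) := reaches_chain h0 hstep
  have hgen := fun j => exists_genuineStep_of_iso hRf hRa hX hν (hreach (g j)) (hstep (g j)) (g_blown j)
    (hI (g j) (g_blown j))
  choose Cc x' hC hmax hπ hcl hiso using hgen
  -- links: `𝒪_{Bℓ,x'_j} ≅ 𝒪_{X_{g j + 1}} ≅ 𝒪_{X_{g (j+1)}}` (waiting segment)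
  have hlink : ∀ j, Nonempty ((blowup (Cc j)).presheaf.stalk (x' j) ≅
      (c (g (j + 1))).W.presheaf.stalk (c (g (j + 1))).pt) := by
    intro j
    obtain ⟨e₁⟩ := hiso j
    obtain ⟨e₂⟩ := nonempty_stalkIso_of_waiting hstep (a := g j + 1) (b := g (j + 1))
      (by rw [g_succ]; exact (next_spec _).1) (fun m hm hlt => next_wait (g j + 1) m hm (by rw [← g_succ]; exact hlt))
    exact ⟨e₁ ≪≫ e₂⟩
  -- the stage tower
  haveI : ∀ j, IsLocallyNoetherian (c (g j)).W := fun j => (c (g j)).ln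
  have hx0 : IsClosed ({(c (g 0)).pt} : Set (c (g 0)).W) := Reaches.isClosed_pt hX.isClosed (hreach (g 0))
  obtain ⟨T, y, hC', hycl, hover, hstalk, htr⟩ :=
    exists_stageTower (W := fun j => (c (g j)).W) (W' := fun j => blowup (Cc j)) (fun j => blowup.π (Cc j)) Cc
      (fun j => blowup.isBlowup (Cc j)) hC (fun j => (c (g j)).pt) hmax x' hπ hcl hlink hx0
  exact ⟨g, T, y, g_mono, g_blown, g_all, hC', hycl, hover, hstalk, htr⟩

end Summit.ResolutionOfSingularities.ResolutionOfSingularities.Theorems.SigmaMaxModificationsCorridor3.Moving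

end
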